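/-
Copyright (c) 2026. All rights reserved.
Released under Apache 2.0 license as described in the file LICENSE.
Authors: abc-iut cell, prover seat abc-iut-w6-d031 (gen 5; PROOF-ONLY, classical complex analysis —
the great Picard theorem via the modular function `λ`).
-/
import Literature.Analysis.Complex.GreatPicardMonodromy
import Literature.NumberTheory.Automorphic.ModularLambdaAnharmonicUniform
import Literature.NumberTheory.Automorphic.SL2ZParabolicConjugate
import HarnessLib

/-!
# The great Picard theorem (via the modular function `λ`)

É. Picard (1879); J. B. Conway, *Functions of One Complex Variable I* (1978), Ch. XII Thm. 4.2 «the
Great Picard Theorem»: a holomorphic function on a punctured disc which omits two values does not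
have an essential singularity.  Route of L. V. Ahlfors, *Complex Analysis* (1979), Ch. 8 §3.4, through
the modular function: by abc-iut-w6-d031's `GreatPicard.monodromy_dichotomy` either `f` has a limit in
`ℂ ∖ {0, 1}`, or its `λ`-lift `F : ℍₒ → ℍₒ` has PARABOLIC monodromy `γ ∈ Γ(2)`; conjugating `γ` to a
translation `u ↦ u + h` (`h` even) by `A ∈ SL₂(ℤ)` (`SL2Z.exists_conj_smul_eq_add_even`), the
function `e^{iπ A·F}` is `1`-periodic, descends to the punctured disc and has a removable singularity
with value `k₀`, `|k₀| < 1`: if `k₀ = 0` then `Im (A · F) → ∞`, `λ(A · F) → 0` and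
`f = λ(A⁻¹ · (A · F)) → 0, 1` or `∞` by the anharmonic law
(`ModularLambda.tendsto_modularLambda_smul_of_tendsto_zero`); if `k₀ ≠ 0` then `A · F` converges
modulo `2ℤ` and `f` converges in `ℂ`.  PROOF-ONLY (no definitions, no named facts):

* `GreatPicard.modularLambda_add_two_mul_int` — `λ(τ + 2n) = λ(τ)`;
* ★ `GreatPicard.tendsto_or_tendsto_cocompact` — **GREAT PICARD**: `f` holomorphic on
  `0 < |z| < 1` omitting `0` and `1` ⇒ `f` has a limit in `ℂ` at `0` (removable singularity) or
  `f → ∞` (a pole).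

Consumer (abc-iut cell): hypothesis (FC) «finitely many cusp classes» of the [AbsTopIII] Prop 4.2 (i)
geometric column for abstract Möbius deck groups (cusp maps of parabolic elements land on punctures).

## References

* J. B. Conway, *Functions of One Complex Variable I*, GTM 11 (1978), Ch. XII Thm. 4.2. [Conway1978]
* L. V. Ahlfors, *Complex Analysis*, 3rd ed. (1979), Ch. 8 §3.4. [Ahlfors1979]
-/

set_option autoImplicit false

noncomputable section

open Complex Filter Topology Metric Set Function
open scoped Real UpperHalfPlane MatrixGroups
open UpperHalfPlane (upperHalfPlaneSet isOpen_upperHalfPlaneSet)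
open Literature.Analysis.Complex.TranslationEquivariant
open Literature.NumberTheory.Automorphic Literature.NumberTheory.Automorphic.ModularLambda

namespace Literature.Analysis.Complex

namespace GreatPicard

/-- `λ(τ + 2n) = λ(τ)` for `n ∈ ℤ` (`λ` has period `2`). [cite: Ahlfors1979, Ch. 8 §3.4] -/
theorem modularLambda_add_two_mul_int (τ : ℂ) (n : ℤ) :
    modularLambda (τ + 2 * n) = modularLambda τ := by
  have hnat : ∀ (k : ℕ) (u : ℂ), modularLambda (u + 2 * k) = modularLambda u := by
    intro k
    induction k with
    | zero => intro u; simp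
    | succ k ih =>
      intro u
      have : u + 2 * ((k + 1 : ℕ) : ℂ) = (u + 2 * k) + 2 := by push_cast; ring
      rw [this, modularLambda_add_two, ih]
  obtain ⟨k, rfl | rfl⟩ := n.eq_nat_or_neg
  · exact_mod_cast hnat k τ
  · have := hnat k (τ + 2 * ((-(k : ℤ) : ℤ) : ℂ))
    rw [← this]
    congr 1
    push_cast
    ring

/-- ★ **The great Picard theorem.**  If `f` is holomorphic on the punctured unit disc and omits the two
values `0` and `1`, then either `f (z)` converges in `ℂ` as `z → 0` (removable singularity) or
`f (z) → ∞` (pole) — `0` is not an essential singularity. [cite: Conway1978, Ch. XII Thm. 4.2]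
[cite: Ahlfors1979, Ch. 8 §3.4] -/
theorem tendsto_or_tendsto_cocompact {f : ℂ → ℂ} (hf : DifferentiableOn ℂ f (ball (0 : ℂ) 1 \ {0}))
    (h0 : ∀ z ∈ ball (0 : ℂ) 1 \ {0}, f z ≠ 0) (h1 : ∀ z ∈ ball (0 : ℂ) 1 \ {0}, f z ≠ 1) :
    (∃ L : ℂ, Tendsto f (𝓝[≠] 0) (𝓝 L)) ∨ Tendsto f (𝓝[≠] 0) (cocompact ℂ) := by
  classical
  rcases monodromy_dichotomy hf h0 h1 with ⟨L, -, -, hL⟩ | ⟨F, γ, hγ, hpar, hFd, hmaps, hlift, heq⟩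
  · exact Or.inl ⟨L, hL⟩
  -- §1 the monodromy is conjugate to an even translation
  have htr : (γ 0 0 + γ 1 1) ^ 2 = 4 := by
    have h := hpar.2
    rw [Matrix.discr_fin_two, Matrix.trace_fin_two, Matrix.SpecialLinearGroup.det_coe] at h
    have : ((γ : Matrix (Fin 2) (Fin 2) ℤ) 0 0 + (γ : Matrix (Fin 2) (Fin 2) ℤ) 1 1) ^ 2 = 4 := by
      linarith
    exact this
  obtain ⟨A, h, ⟨m, hm⟩, hconj⟩ := SL2Z.exists_conj_smul_eq_add_even hγ htr
  -- §2 the lift as a map into `ℍ`, and its conjugate `U = A • Fh`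
  let Fh : ℂ → ℍ := fun w => if hw : 0 < w.im then UpperHalfPlane.mk (F w) (hmaps hw) else UpperHalfPlane.I
  have hFh : ∀ w : ℂ, 0 < w.im → ((Fh w : ℍ) : ℂ) = F w := fun w hw => by
    simp only [Fh, dif_pos hw, UpperHalfPlane.coe_mk]
  have hFhT : ∀ w : ℂ, 0 < w.im → Fh (w + 1) = γ • Fh w := fun w hw => by
    have hw1 : 0 < (w + 1).im := by simpa using hw
    apply UpperHalfPlane.ext
    rw [hFh _ hw1, heq w hw, UpperHalfPlane.coe_specialLinearGroup_apply]
    simp only [eq_intCast, hFh w hw]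
  let U : ℂ → ℍ := fun w => A • Fh w
  have hUT : ∀ w : ℂ, 0 < w.im → ((U (w + 1) : ℍ) : ℂ) = (U w : ℂ) + h := fun w hw => by
    show (((A • Fh (w + 1)) : ℍ) : ℂ) = ((A • Fh w : ℍ) : ℂ) + h
    rw [hFhT w hw, smul_smul, ← hconj (A • Fh w), smul_smul, inv_mul_cancel_right]
  -- the coordinate function `F₁ = coe ∘ U`: holomorphic on `ℍₒ`
  set a : ℝ := (((A : Matrix (Fin 2) (Fin 2) ℤ) 0 0 : ℤ) : ℝ) with ha
  set b : ℝ := (((A : Matrix (Fin 2) (Fin 2) ℤ) 0 1 : ℤ) : ℝ) with hb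
  set c : ℝ := (((A : Matrix (Fin 2) (Fin 2) ℤ) 1 0 : ℤ) : ℝ) with hc
  set d : ℝ := (((A : Matrix (Fin 2) (Fin 2) ℤ) 1 1 : ℤ) : ℝ) with hd
  have hadA : a * d - b * c = 1 := by
    have h' := Matrix.SpecialLinearGroup.det_coe A
    rw [Matrix.det_fin_two] at h'
    rw [ha, hb, hc, hd]; exact_mod_cast h'
  have hUcoe : ∀ w : ℂ, 0 < w.im → ((U w : ℍ) : ℂ) = ((a : ℂ) * F w + b) / ((c : ℂ) * F w + d) := by
    intro w hw
    show (((A • Fh w) : ℍ) : ℂ) = _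
    rw [UpperHalfPlane.coe_specialLinearGroup_apply]
    simp only [eq_intCast, hFh w hw, ha, hb, hc, hd]
  let F₁ : ℂ → ℂ := fun w => ((U w : ℍ) : ℂ)
  have hF₁d : DifferentiableOn ℂ F₁ upperHalfPlaneSet := by
    have hg : DifferentiableOn ℂ (fun w => ((a : ℂ) * F w + b) / ((c : ℂ) * F w + d)) upperHalfPlaneSet :=
      ((hFd.const_mul _).add_const _).div ((hFd.const_mul _).add_const _)
        fun w hw => denom_ne_zero hadA (hmaps hw)
    exact hg.congr fun w hw => hUcoe w hw
  have hF₁pos : ∀ w : ℂ, 0 < (F₁ w).im := fun w => (U w).im_pos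
  -- §3 `Φ = e^{iπ F₁}` is `1`-periodic and bounded by `1`; descend it to the punctured disc
  let Φ : ℂ → ℂ := fun w => exp (π * I * F₁ w)
  have hΦd : DifferentiableOn ℂ Φ upperHalfPlaneSet :=
    differentiable_exp.comp_differentiableOn (hF₁d.const_mul _)
  have hΦper : ∀ w : ℂ, 0 < w.im → Φ (w + 1) = Φ w := fun w hw => by
    show exp (π * I * F₁ (w + 1)) = exp (π * I * F₁ w)
    have : F₁ (w + 1) = F₁ w + h := hUT w hw
    rw [this, hm, mul_add, Complex.exp_add]
    push_cast
    have : (π * I * (2 * (m : ℂ)) : ℂ) = m * (2 * π * I) := by ring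
    rw [this, Complex.exp_int_mul_two_pi_mul_I, mul_one]
  have hΦnorm : ∀ w : ℂ, ‖Φ w‖ = Real.exp (-π * (F₁ w).im) := fun w => by
    show ‖exp (π * I * F₁ w)‖ = _
    rw [Complex.norm_exp]
    congr 1
    simp only [Complex.mul_re, Complex.mul_im, Complex.ofReal_re, Complex.ofReal_im, Complex.I_re,
      Complex.I_im, mul_zero, sub_zero, zero_mul, add_zero, mul_one]
    ring
  have hΦlt : ∀ w : ℂ, ‖Φ w‖ < 1 := fun w => by
    rw [hΦnorm, ← Real.exp_zero, Real.exp_lt_exp]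
    nlinarith [Real.pi_pos, hF₁pos w]
  obtain ⟨K, hKd, hKE, -⟩ := exists_descent_exp hΦper hΦd
  -- §4 removable singularity of `K` at `0`, value `k₀` with `|k₀| < 1`
  have hpd_open : IsOpen (ball (0 : ℂ) 1 \ {0}) := isOpen_ball.sdiff isClosed_singleton
  -- `K z = Φ (w_z)` with `w_z = log z / 2πi`
  let wz : ℂ → ℂ := fun z => log z / (2 * π * I)
  have hwz : ∀ z : ℂ, z ≠ 0 → ‖z‖ < 1 → 0 < (wz z).im := fun z hz hz1 => im_logBranch_pos hz hz1
  have hKz : ∀ z : ℂ, z ≠ 0 → ‖z‖ < 1 → K z = Φ (wz z) := fun z hz hz1 => by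
    have := hKE (wz z) (hwz z hz hz1)
    rwa [exp_logBranch hz] at this
  have hKlt : ∀ z : ℂ, z ≠ 0 → ‖z‖ < 1 → ‖K z‖ < 1 := fun z hz hz1 => by
    rw [hKz z hz hz1]; exact hΦlt _
  have hKne : ∀ z : ℂ, z ≠ 0 → ‖z‖ < 1 → K z ≠ 0 := fun z hz hz1 => by
    rw [hKz z hz hz1]; exact exp_ne_zero _
  have hev : ∀ᶠ z in 𝓝[≠] (0 : ℂ), z ∈ ball (0 : ℂ) 1 \ {0} := by
    have hb : ball (0 : ℂ) 1 ∈ 𝓝 (0 : ℂ) := ball_mem_nhds _ one_pos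
    filter_upwards [mem_nhdsWithin_of_mem_nhds hb, self_mem_nhdsWithin] with z hz hz0
    exact ⟨hz, hz0⟩
  have hKda : ∀ᶠ z in 𝓝[≠] (0 : ℂ), DifferentiableAt ℂ K z :=
    hev.mono fun z hz => (hKd z hz).differentiableAt (hpd_open.mem_nhds hz)
  have hKb : IsBoundedUnder (· ≤ ·) (𝓝[≠] (0 : ℂ)) fun z => ‖K z - K 0‖ :=
    ⟨1 + ‖K 0‖, hev.mono fun z hz =>
      (norm_sub_le _ _).trans (by linarith [hKlt z hz.2 (mem_ball_zero_iff.mp hz.1)])⟩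
  have hlimK := Complex.tendsto_limUnder_of_differentiable_on_punctured_nhds_of_bounded_under hKda hKb
  set k₀ : ℂ := limUnder (𝓝[≠] (0 : ℂ)) K with hk₀
  have hbdd : BddAbove (norm ∘ K '' (ball (0 : ℂ) 1 \ {0})) :=
    ⟨1, by rintro _ ⟨z, hz, rfl⟩; exact (hKlt z hz.2 (mem_ball_zero_iff.mp hz.1)).le⟩
  have hKupd : DifferentiableOn ℂ (update K 0 k₀) (ball (0 : ℂ) 1) :=
    Complex.differentiableOn_update_limUnder_of_bddAbove (ball_mem_nhds _ one_pos) hKd hbdd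
  have hk₀le : ‖k₀‖ ≤ 1 :=
    le_of_tendsto hlimK.norm (hev.mono fun z hz => (hKlt z hz.2 (mem_ball_zero_iff.mp hz.1)).le)
  have hk₀lt : ‖k₀‖ < 1 := by
    rcases lt_or_eq_of_le hk₀le with hlt | heq1
    · exact hlt
    · exfalso
      have hmax : IsMaxOn (norm ∘ update K 0 k₀) (ball (0 : ℂ) 1) 0 := fun z hz => by
        by_cases hz0 : z = 0
        · subst hz0
          show (norm ∘ update K 0 k₀) 0 ≤ (norm ∘ update K 0 k₀) 0
          exact le_rfl
        · show ‖update K 0 k₀ z‖ ≤ ‖update K 0 k₀ 0‖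
          rw [update_of_ne hz0, update_self, heq1]
          exact (hKlt z hz0 (mem_ball_zero_iff.mp hz)).le
      have hc := Complex.eqOn_of_isPreconnected_of_isMaxOn_norm (convex_ball (0 : ℂ) 1).isPreconnected
        isOpen_ball hKupd (mem_ball_self one_pos) hmax
      have hhalf : ((1 : ℂ) / 2) ∈ ball (0 : ℂ) 1 := by rw [mem_ball_zero_iff]; norm_num
      have hhalf0 : ((1 : ℂ) / 2) ≠ 0 := by norm_num
      have hval := hc hhalf
      simp only [const_apply, update_self, update_of_ne hhalf0] at hval
      have hlt := hKlt _ hhalf0 (mem_ball_zero_iff.mp hhalf)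
      rw [hval, heq1] at hlt
      exact lt_irrefl _ hlt
  -- §5 `f z = λ(A⁻¹ • U (w_z))` and `Im U (w_z) = -log ‖K z‖ / π`
  have hfz : ∀ z : ℂ, z ≠ 0 → ‖z‖ < 1 →
      f z = modularLambda (((A⁻¹ • U (wz z)) : ℍ) : ℂ) := fun z hz hz1 => by
    have hw := hwz z hz hz1
    have h' : modularLambda (F (wz z)) = f (exp (2 * π * I * wz z)) := hlift (wz z) hw
    rw [exp_logBranch hz] at h'
    rw [← h', ← hFh _ hw]
    show modularLambda ((Fh (wz z) : ℍ) : ℂ) = modularLambda (((A⁻¹ • A • Fh (wz z)) : ℍ) : ℂ)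
    rw [inv_smul_smul]
  have hImU : ∀ z : ℂ, z ≠ 0 → ‖z‖ < 1 → (U (wz z)).im = -Real.log ‖K z‖ / π := fun z hz hz1 => by
    have hn : ‖K z‖ = Real.exp (-π * (F₁ (wz z)).im) := by rw [hKz z hz hz1, hΦnorm]
    rw [hn, Real.log_exp]
    have : (F₁ (wz z)).im = (U (wz z)).im := (UpperHalfPlane.coe_im _)
    rw [this]
    field_simp
  -- §6 the dichotomy on `k₀`
  by_cases hk0 : k₀ = 0
  · -- `Im U → ∞`, `λ(U) → 0`, and `f = λ(A⁻¹ • U) → 0, 1` or `∞`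
    have hnormK : Tendsto (fun z => ‖K z‖) (𝓝[≠] (0 : ℂ)) (𝓝[>] 0) := by
      refine tendsto_nhdsWithin_iff.mpr ⟨?_, hev.mono fun z hz =>
        norm_pos_iff.mpr (hKne z hz.2 (mem_ball_zero_iff.mp hz.1))⟩
      have := hlimK.norm
      rw [hk0, norm_zero] at this
      exact this
    have hlog : Tendsto (fun z => -Real.log ‖K z‖ / π) (𝓝[≠] (0 : ℂ)) atTop := by
      have h1 := Real.tendsto_log_nhdsGT_zero.comp hnormK
      have h2 : Tendsto (fun z => -Real.log ‖K z‖) (𝓝[≠] (0 : ℂ)) atTop :=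
        tendsto_neg_atBot_atTop.comp h1
      exact h2.atTop_div_const Real.pi_pos
    have hImlim : Tendsto (fun z => ((U (wz z) : ℍ) : ℂ).im) (𝓝[≠] (0 : ℂ)) atTop := by
      refine hlog.congr' (hev.mono fun z hz => ?_)
      show -Real.log ‖K z‖ / π = ((U (wz z) : ℍ) : ℂ).im
      rw [UpperHalfPlane.coe_im, hImU z hz.2 (mem_ball_zero_iff.mp hz.1)]
    have hlamU : Tendsto (fun z => modularLambda ((U (wz z) : ℍ) : ℂ)) (𝓝[≠] (0 : ℂ)) (𝓝 0) :=
      tendsto_modularLambda.comp (tendsto_comap_iff.mpr hImlim)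
    have hcases := tendsto_modularLambda_smul_of_tendsto_zero A⁻¹ (z := fun z => U (wz z)) hlamU
    have hfeq : ∀ᶠ z in 𝓝[≠] (0 : ℂ), modularLambda (((A⁻¹ • U (wz z)) : ℍ) : ℂ) = f z :=
      hev.mono fun z hz => (hfz z hz.2 (mem_ball_zero_iff.mp hz.1)).symm
    rcases hcases with hc | hc | hc
    · exact Or.inl ⟨0, hc.congr' hfeq⟩
    · exact Or.inl ⟨1, hc.congr' hfeq⟩
    · exact Or.inr (hc.congr' hfeq)
  · -- `K z → k₀ ≠ 0`: `U` converges modulo `2ℤ`, hence `f` converges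
    left
    have hk0n : 0 < ‖k₀‖ := norm_pos_iff.mpr hk0
    -- the base point `u* = log k₀ / (iπ)`, `e^{iπ u*} = k₀`, `Im u* = -log |k₀| / π > 0`
    set us : ℂ := log k₀ / (π * I) with hus
    have husexp : exp (π * I * us) = k₀ := by
      rw [hus, mul_div_cancel₀ _ (by simp [Real.pi_ne_zero, I_ne_zero] : (π * I : ℂ) ≠ 0)]
      exact exp_log hk0
    have husim : us.im = -Real.log ‖k₀‖ / π := by
      have hre : (π * I : ℂ).re = 0 := by simp
      have him : (π * I : ℂ).im = π := by simp
      have hn : Complex.normSq (π * I : ℂ) = π ^ 2 := by rw [Complex.normSq_apply, hre, him]; ring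
      rw [hus, Complex.div_im, hre, him, hn, Complex.log_re]
      field_simp
      ring
    have huspos : 0 < us.im := by
      rw [husim]
      have : Real.log ‖k₀‖ < 0 := Real.log_neg hk0n hk₀lt
      exact div_pos (by linarith) Real.pi_pos
    -- the continuous local lift `u z = u* + log (K z / k₀) / (iπ)`
    let u : ℂ → ℂ := fun z => us + log (K z / k₀) / (π * I)
    have hulim : Tendsto u (𝓝[≠] (0 : ℂ)) (𝓝 us) := by
      have h1 : Tendsto (fun z => K z / k₀) (𝓝[≠] (0 : ℂ)) (𝓝 1) := by
        have := hlimK.div_const k₀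
        rwa [div_self hk0] at this
      have h2 : Tendsto (fun z => log (K z / k₀)) (𝓝[≠] (0 : ℂ)) (𝓝 0) := by
        have hc : ContinuousAt log (1 : ℂ) := continuousAt_clog (by simp)
        have := hc.tendsto.comp h1
        rwa [Complex.log_one] at this
      have h3 : Tendsto (fun z => log (K z / k₀) / (π * I)) (𝓝[≠] (0 : ℂ)) (𝓝 0) := by
        simpa using h2.div_const (π * I : ℂ)
      simpa [u] using (tendsto_const_nhds (x := us)).add h3
    have huexp : ∀ z : ℂ, z ≠ 0 → ‖z‖ < 1 → exp (π * I * u z) = K z := fun z hz hz1 => by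
      show exp (π * I * (us + log (K z / k₀) / (π * I))) = K z
      rw [mul_add, Complex.exp_add, husexp,
        mul_div_cancel₀ _ (by simp [Real.pi_ne_zero, I_ne_zero] : (π * I : ℂ) ≠ 0),
        exp_log (div_ne_zero (hKne z hz hz1) hk0)]
      field_simp
    -- `U (w_z) = u z + 2 n_z`, hence `λ(A⁻¹ • U (w_z)) = λ(A⁻¹ • ⟨u z⟩)` for `z` close to `0`
    have hevu : ∀ᶠ z in 𝓝[≠] (0 : ℂ), 0 < (u z).im := by
      have : ∀ᶠ z in 𝓝[≠] (0 : ℂ), u z ∈ upperHalfPlaneSet :=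
        hulim (isOpen_upperHalfPlaneSet.mem_nhds huspos)
      exact this
    have hkey : ∀ z : ℂ, z ≠ 0 → ‖z‖ < 1 → ∀ hu : 0 < (u z).im,
        modularLambda (((A⁻¹ • U (wz z)) : ℍ) : ℂ) =
          modularLambda (((A⁻¹ • UpperHalfPlane.mk (u z) hu) : ℍ) : ℂ) := by
      intro z hz hz1 hu
      -- `F₁ (w_z) = u z + 2 n`
      have hexp : exp (π * I * u z) = exp (π * I * F₁ (wz z)) := by
        rw [huexp z hz hz1, hKz z hz hz1]
      obtain ⟨n, hn⟩ := Complex.exp_eq_exp_iff_exists_int.mp hexp.symm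
      have hπI : (π * I : ℂ) ≠ 0 := by simp [Real.pi_ne_zero, I_ne_zero]
      have hF₁u : F₁ (wz z) = u z + 2 * n := by
        have h3 : π * I * F₁ (wz z) = π * I * (u z + 2 * n) := by rw [hn]; ring
        exact mul_left_cancel₀ hπI h3
      have hper2 : modularLambda ((U (wz z) : ℍ) : ℂ) =
          modularLambda ((UpperHalfPlane.mk (u z) hu : ℍ) : ℂ) := by
        show modularLambda (F₁ (wz z)) = modularLambda (u z)
        rw [hF₁u, modularLambda_add_two_mul_int]
      rcases modularLambda_smul_eq_or_forall A⁻¹ with hφ | hφ | hφ | hφ | hφ | hφ <;>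
        rw [hφ, hφ, hper2]
    -- continuity of `v ↦ λ(A⁻¹ • v)` on `ℍ` at `u*`
    set L : ℂ := modularLambda (((A⁻¹ • UpperHalfPlane.mk us huspos) : ℍ) : ℂ) with hL
    refine ⟨L, ?_⟩
    have hcont : Continuous fun v : ℍ => modularLambda (((A⁻¹ • v) : ℍ) : ℂ) :=
      continuous_modularLambda_comp_coe.comp
        (continuous_const_smul (Matrix.SpecialLinearGroup.mapGL ℝ A⁻¹ : GL (Fin 2) ℝ))
    -- the map `z ↦ ⟨u z, _⟩ ∈ ℍ` along `𝓝[≠] 0`, defined eventually; use `ofComplex`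
    have hulimH : Tendsto (fun z => UpperHalfPlane.ofComplex (u z)) (𝓝[≠] (0 : ℂ))
        (𝓝 (UpperHalfPlane.mk us huspos)) := by
      have hc : ContinuousAt UpperHalfPlane.ofComplex us :=
        (UpperHalfPlane.mdifferentiableAt_ofComplex huspos).continuousAt
      have := hc.tendsto.comp hulim
      rwa [UpperHalfPlane.ofComplex_apply_of_im_pos huspos] at this
    have hmain : Tendsto (fun z => modularLambda (((A⁻¹ • UpperHalfPlane.ofComplex (u z)) : ℍ) : ℂ))
        (𝓝[≠] (0 : ℂ)) (𝓝 L) := by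
      rw [hL]
      exact (hcont.tendsto _).comp hulimH
    refine hmain.congr' ?_
    filter_upwards [hev, hevu] with z hz hu
    rw [UpperHalfPlane.ofComplex_apply_of_im_pos hu, ← hkey z hz.2 (mem_ball_zero_iff.mp hz.1) hu,
      hfz z hz.2 (mem_ball_zero_iff.mp hz.1)]

end GreatPicard

end Literature.Analysis.Complex

end
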